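import Mathlib
import Summits.MatrixMultiplication.Statement
import Summits.MatrixMultiplication.MatrixMultiplication.Theorems.GraphEquationsExactEngineThree

/-!
# Graph equations — the e = 3 engine in the ALL-ALIVE regime, fields from sections (M19p)

Composition check of M19n + M19o: the base-free field supply feeds the level-2 engine.

* `exists_affField_V01_of_kernelSection'` — `exists_affField_V01_of_kernelSection` for a family over an
  arbitrary finite index type (the level-1 output family is indexed by `Fin T ⊕ Fin T`);
* `tensorRank_le_of_cubeMembers_alive` — tests `t_o ∈ I` of nonscalar length `≤ N`, a cost-free affine
  field `ξ₁` with V0/V1 on `t` alive on every coordinate, an EXACT polynomial kernel section `η₂` of the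
  row matrix of `t ∪ D_{ξ₁}t` alive on every coordinate at `0`, and exact cube members with unit
  multipliers ⇒ `R(⟨n,n,n⟩) ≤ 18N`.  (No serving needed: the regime complementary to the semi-forced
  residual.)
-/

set_option linter.dupNamespace false

noncomputable section

open scoped BigOperators

namespace Summit.MatrixMultiplication.MatrixMultiplication.Theorems.GraphEquations

open MvPolynomial
open Literature.Computability.AlgebraicComplexity
open Literature.Computability.AlgebraicComplexity.ArithCircuit

variable {n : ℕ}

/-- **Base-free field supply over an arbitrary finite index type.** -/
theorem exists_affField_V01_of_kernelSection' {ο : Type*} [Fintype ο]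
    (t : ο → MvPolynomial (GraphVars n) ℂ) (η : Fin n × Fin n → MvPolynomial (MatMulVars n) ℂ)
    (hker : ∀ o, ∑ q, rowPoly (t o) q * η q = 0) :
    ∃ lam : Fin n × Fin n → MatMulVars n → ℂ,
      (∀ q, liftAB n (affField (fun q => eval 0 (η q)) lam q) ∈
        freeSpan (∅ : Set (MvPolynomial (GraphVars n) ℂ))) ∧
      (∀ q, coeff 0 (affField (fun q => eval 0 (η q)) lam q) = eval 0 (η q)) ∧
      (∀ o, coeff 0 (derivC (affField (fun q => eval 0 (η q)) lam) (t o)) = 0) ∧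
      ∀ o (v : MatMulVars n), coeff (Finsupp.single (Sum.inl v : GraphVars n) 1)
        (derivC (affField (fun q => eval 0 (η q)) lam) (t o)) = 0 := by
  classical
  set e := Fintype.equivFin ο with he
  obtain ⟨lam, hfree, hval, hV0, hV1⟩ :=
    exists_affField_V01_of_kernelSection (fun i => t (e.symm i)) η (fun i => hker _)
  refine ⟨lam, hfree, hval, fun o => ?_, fun o v => ?_⟩
  · simpa only [Equiv.symm_apply_apply] using hV0 (e o)
  · simpa only [Equiv.symm_apply_apply] using hV1 (e o) v

/-- **The e = 3 engine, all coordinates alive, second field from an exact section.** -/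
theorem tensorRank_le_of_cubeMembers_alive {N T : ℕ} (t : Fin T → MvPolynomial (GraphVars n) ℂ)
    (hspan : ∃ gs : List (MvPolynomial (GraphVars n) ℂ), IsNonscalarSeq gs ∧ gs.length ≤ N ∧
      ∀ o, t o ∈ freeSpan {q | q ∈ gs})
    (ht : ∀ o, t o ∈ graphIdeal n)
    (ξ₁ : Fin n × Fin n → MvPolynomial (MatMulVars n) ℂ)
    (hξ₁ : ∀ q, liftAB n (ξ₁ q) ∈ freeSpan (∅ : Set (MvPolynomial (GraphVars n) ℂ)))
    (hV0₁ : ∀ o, coeff 0 (derivC ξ₁ (t o)) = 0)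
    (hV1₁ : ∀ o (v : MatMulVars n),
      coeff (Finsupp.single (Sum.inl v : GraphVars n) 1) (derivC ξ₁ (t o)) = 0)
    (halive₁ : ∀ q, coeff 0 (ξ₁ q) ≠ 0)
    (η₂ : Fin n × Fin n → MvPolynomial (MatMulVars n) ℂ)
    (hker₂ : ∀ o : Fin T ⊕ Fin T,
      ∑ q, rowPoly (Sum.elim t (fun o => derivC ξ₁ (t o)) o) q * η₂ q = 0)
    (halive₂ : ∀ q, eval 0 (η₂ q) ≠ 0)
    (hcube : ∀ q : Fin n × Fin n, ∃ (g : MvPolynomial (MatMulVars n) ℂ)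
      (h : Fin T → MvPolynomial (GraphVars n) ℂ), coeff 0 g ≠ 0 ∧
        ∑ o, h o * t o = liftAB n g * generator n q ^ 3) :
    tensorRank (matMulTensor ℂ n n n) ≤ 2 * (9 * N) := by
  classical
  obtain ⟨lam, hfree, hval, hV0, hV1⟩ :=
    exists_affField_V01_of_kernelSection' (Sum.elim t (fun o => derivC ξ₁ (t o))) η₂ hker₂
  refine tensorRank_le_of_cubeMembers_affine2 t hspan ht ξ₁ (affField (fun q => eval 0 (η₂ q)) lam)
    hξ₁ hfree hV0₁ hV1₁ (fun o => ⟨?_, ?_⟩) (fun o v => ⟨?_, ?_⟩) fun q => Or.inl ⟨halive₁ q, ?_, hcube q⟩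
  · simpa only [Sum.elim_inl] using hV0 (Sum.inl o)
  · simpa only [Sum.elim_inr] using hV0 (Sum.inr o)
  · simpa only [Sum.elim_inl] using hV1 (Sum.inl o) v
  · simpa only [Sum.elim_inr] using hV1 (Sum.inr o) v
  · rw [hval]; exact halive₂ q

end Summit.MatrixMultiplication.MatrixMultiplication.Theorems.GraphEquations

end
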